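import Summits.QuantumFields.BalabanUV.T4Continuum.Support.NE9LinSizeEnd
import Summits.QuantumFields.BalabanUV.T4Continuum.Support.NE9MixedCurrencyKP

/-!
# NE9MixedCurrencyEnd — E5‴: the torus END face of the P2 road (`TermSize ∧ NE9 ∧ FadingMemory`) with the LIP side and the KP side
# discharged in the MIXED currency of `NE9MixedCurrencyKP` (p250598): volume entropy, linear-size decay weights — the d-currency's
# animal constant `2^(ν+1+2^ν)` (2²¹ on T⁴) appears NOWHERE (refuter PRICING-NE9 v3 §C(5), Q-N2-1, sizing line (R-anim); leaf-01 g44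
# `N2-R0R1-FACES` (F2): the two E5′ binders `hliplb` ∕ `hsmall`; cell `pub-balaban`, T4-DAG §2 node U3 ∕ §6 NE9; BINDER row NE9 OWNER
# lineage `b2b-balaban-t4-ne9-p1`, generation 59, T31-instancer lane; Summits-side NEW work; nothing printed asserted)

HONEST FRAMING (T4-DAG PAGE 1).  Rung (B)+1 of the FINITE-VOLUME T⁴ programme — NOT infinite volume, NOT a mass gap, NOT the Clay
problem.  NE9 (`T4OutputRate.NE9` ∧ `FadingMemory`) is a cell NEW ESTIMATE, NOT PRINTED in [I] = [Balaban1987RG1] (CMP **109**), [II] =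
[Balaban1988RG2Cluster] (CMP **116**), and NOT PROVED here («NE9 ⇐ the named binders»; spine PROVED 0∕9).  HONEST DEPENDENCY (cell line,
verbatim): continuum YM on T⁴ ⇐ BetaPertH ∧ nine spine estimates (0/9 proved); BetaPertH ⇐ (D1) ∧ (D4) ∧ CAP+tail; G-an2-4 gates asym, D1
and NE2/3/4.  Every analytic input stays a DISPLAYED binder ((A″) the box-majorant decay, (L‴) the table decay, the recursion side); what is
proved is the composition BY NAME of tree theorems; 0 def, 0 sorry.

WHAT.  E5′ (`NE9LinSizeEnd.torus_termSize_ne9_and_fadingMemory_of_linSizeDischargers`, leaf-10) discharged the lip floor and the KP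
smallness in the d-currency, where the (1.26)-type entropy constant is `2^(ν+1+2^ν)` (index set (R0), `d = 0` shell absorbed; refuter's
n₀(4) = 329 545).  THIS FILE is the same END with those two binders taken from `NE9MixedCurrencyKP`: §1 `pin_of_mixedDecay` ((L‴) mixed ⇒
the pinned scale bound with `α₄(k)·θ₀ ≤ lip k`, `y·e^{Dθ₀} ≤ θ₀`); §2 `two_mul_one_add_card_mul_le_mixed` (the segment majorant's factor
`1 + #γ′` absorbed as `y ↦ 2y`); §3 **`torus_termSize_ne9_and_fadingMemory_of_mixedDischargers`** (E5‴) — conclusion VERBATIM E5′'s.  So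
the census at L = M = 13 can be run on an END in THREE columns: (R0) d-currency (E5′), MIXED (this file; needs only the volume letter
`y ↔ e^{−¼(κ₁−1)}`), (R1) support clause (not in the tree).  HONEST RIDER as in `NE9MixedCurrencyKP`: the volume factor is printed TYPE on the
TABLE side ((2.19) p. 16) and the instancer's choice on the ACTIVITY side ((2.38) is pure tree-length); N2 stays class S.

References (TYPES ∕ loci only): [Balaban1988RG2Cluster] T. Bałaban, CMP **116** (1988), (1.26) p. 8, (1.36) p. 9, (2.18)–(2.20) p. 16,
(2.26)–(2.27) pp. 17–18, Lemma 3 (2.38) p. 20, (2.40)–(2.41) p. 21; [Balaban1987RG1] T. Bałaban, CMP **109** (1987), (0.23) p. 256, p. 257,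
(1.18) p. 263; [KoteckyPreiss1986] (1)–(3); [FriedliVelenik2017] Lemma 3.38.  Imports `NE9LinSizeEnd` and `NE9MixedCurrencyKP` ONLY; modifies
nothing.  Value = the mixed currency reaches `TermSize ∧ NE9 ∧ FadingMemory` by name, NOT summit progress.
-/

noncomputable section

namespace Summit.QuantumFields.BalabanUV.T4Continuum.NE9MixedCurrencyEnd

open scoped BigOperators
open Metric Set MeasureTheory BoundedContinuousFunction
open Literature.Probability.LatticeModels
open Literature.MathematicalPhysics.QuantumFieldTheory
open Literature.MathematicalPhysics.QuantumFieldTheory.Balaban1983to89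
open Literature.MathematicalPhysics.QuantumFieldTheory.Balaban1983to89.T4OutputRate
open Literature.MathematicalPhysics.QuantumFieldTheory.Balaban1983to89.T4ActivityLipschitz
open Literature.MathematicalPhysics.QuantumFieldTheory.Balaban1983to89.T4HistoryLipschitzRecursion
open Literature.MathematicalPhysics.QuantumFieldTheory.Balaban1983to89.T4HistoryLipschitzOuter
open Literature.MathematicalPhysics.QuantumFieldTheory.Balaban1983to89.T4HistoryLipschitzActivity
open Literature.MathematicalPhysics.QuantumFieldTheory.Balaban1983to89.T4HistoryLipschitzEntropy
open Literature.MathematicalPhysics.QuantumFieldTheory.Balaban1983to89.T4HistoryLipschitzCubeGeometry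
open Literature.MathematicalPhysics.QuantumFieldTheory.Balaban1983to89.T4HistoryLipschitzActivity (ClusterGeom)
open Literature.MathematicalPhysics.QuantumFieldTheory.Balaban1983to89.T4HistoryLipschitzSegment
open Literature.MathematicalPhysics.QuantumFieldTheory.Balaban1983to89.T4HistoryLipschitzLinearSize
open Summit.QuantumFields.BalabanUV.T4Continuum.NE9LinSizeEntropy
open Summit.QuantumFields.BalabanUV.T4Continuum.NE9LinSizePinned
open Summit.QuantumFields.BalabanUV.T4Continuum.NE9WeightedClauseEnd
open Summit.QuantumFields.BalabanUV.T4Continuum.NE9LinSizeKP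
open Summit.QuantumFields.BalabanUV.T4Continuum.NE9MixedCurrencyKP

/-! ## §1 The pinned scale bound (L″) from mixed table decay -/

section Pinned

variable {ν : ℕ} {G : Type*} [AddCommGroup G] [One G] [DecidableEq G] {F : Type*} [Fintype F]
  {adj : (Fin ν → G) → (Fin ν → G) → Prop} [DecidableRel adj] [Std.Symm adj] {D : ℕ} {Bg : Type} {Ω : Type*}

/-- **(L‴) MIXED ⇒ (L″) (kernel).**  PER-DOMAIN MIXED DECAY of the coefficient tables `‖c_ω(Y)‖ ≤ αc k·y^{#dom Y}·e^{−a·d(dom Y)}` ((2.19)∕(2.20)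
p. 16 TYPE), `adj`-connectedness of every nonempty domain (degree `≤ D`), injectivity of the domain labelling on nonempty domains,
`y·e^{Dθ₀} ≤ θ₀` and `αc k·θ₀ ≤ lip k` GIVE the pinned scale bound (L″) of `T4HistoryLipschitzSegment.cubeChart_ne9_and_fadingMemory_of_pinned`
at every cube (∘ `NE9MixedCurrencyKP.pinnedSum_le_of_mixedDecay`).  Compare `NE9LinSizePinned.pin_of_linSizeDecay` (`αc k·2^(ν+1+2^ν) ≤ lip k`).
[cite: Balaban1988RG2Cluster, (2.18)-(2.20) p.16, (1.26) p.8] -/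
theorem pin_of_mixedDecay (hD : ∀ (b : Fin ν → G) (Q : Finset (Fin ν → G)), (Q.filter (adj b)).card ≤ D)
    {c : ℕ → ℝ → Bg → Finset (Fin ν → G) → Ω → F → ℂ}
    {dom : ℕ → Finset (Fin ν → G) → F → Finset (Fin ν → G)} {αc lip : ℕ → ℝ} {y a θ₀ : ℝ} (hαc : ∀ k, 0 ≤ αc k)
    (hy : 0 ≤ y) (ha : 0 ≤ a) (hθ₀ : y * Real.exp (D * θ₀) ≤ θ₀) (hliplb : ∀ k, αc k * θ₀ ≤ lip k)
    (hlin : ∀ k s U (γ : Finset (Fin ν → G)) ω Y,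
      ‖c k s U γ ω Y‖ ≤ αc k * y ^ (dom k γ Y).card * Real.exp (-(a * (linSize (dom k γ Y) : ℝ))))
    (hdomconn : ∀ k (γ : Finset (Fin ν → G)) Y, (dom k γ Y).Nonempty →
      ∃ b ∈ dom k γ Y, Polymer.IsConn adj (dom k γ Y) b)
    (hdominj : ∀ k (γ : Finset (Fin ν → G)), Set.InjOn (dom k γ) {Y | (dom k γ Y).Nonempty}) :
    ∀ k s U (γ : Finset (Fin ν → G)) ω, ∀ x ∈ γ,
      ∑ Y ∈ Finset.univ.filter (fun Y => x ∈ dom k γ Y), ‖c k s U γ ω Y‖ ≤ lip k :=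
  fun k s U γ ω x _ =>
    (pinnedSum_le_of_mixedDecay hD (hαc k) hy ha hθ₀ (hlin k s U γ ω) (hdomconn k γ) (hdominj k γ) x).trans (hliplb k)

end Pinned

/-! ## §2 The segment majorant's polynomial factor absorbed into the volume factor: `y ↦ 2y` -/

/-- **`2·((1 + n)·I) ≤ (2ε)·(2y)ⁿ·e^{−a′L}`** whenever `I ≤ ε·yⁿ·e^{−a′L}` (`0 ≤ ε`, `0 ≤ y`; `1 + n ≤ 2ⁿ`). [folklore] -/
theorem two_mul_one_add_card_mul_le_mixed {I ε a' L y : ℝ} {n : ℕ} (hε : 0 ≤ ε) (hy : 0 ≤ y)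
    (hI : I ≤ ε * y ^ n * Real.exp (-(a' * L))) :
    2 * ((1 + (n : ℝ)) * I) ≤ (2 * ε) * (2 * y) ^ n * Real.exp (-(a' * L)) := by
  have hb : 0 ≤ ε * y ^ n * Real.exp (-(a' * L)) := by positivity
  have h2n : 1 + (n : ℝ) ≤ (2:ℝ) ^ n := by
    have h : n < 2 ^ n := Nat.lt_two_pow_self
    have h' : (n : ℝ) + 1 ≤ (2:ℝ) ^ n := by exact_mod_cast h
    linarith
  have h1 : (1 + (n : ℝ)) * I ≤ (1 + (n : ℝ)) * (ε * y ^ n * Real.exp (-(a' * L))) :=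
    mul_le_mul_of_nonneg_left hI (by positivity)
  have h2 : (1 + (n : ℝ)) * (ε * y ^ n * Real.exp (-(a' * L))) ≤ (2:ℝ) ^ n * (ε * y ^ n * Real.exp (-(a' * L))) :=
    mul_le_mul_of_nonneg_right h2n hb
  have e : (2 * ε) * (2 * y) ^ n * Real.exp (-(a' * L)) = 2 * ((2:ℝ) ^ n * (ε * y ^ n * Real.exp (-(a' * L)))) := by
    rw [mul_pow]; ring
  rw [e]
  nlinarith

/-! ## §3 E5‴: the torus END face with the lip side and the KP side in the mixed currency -/

section Torus

variable {ν N : ℕ} {C : Carriers} {D : ℕ}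
variable {Bg : Type} {Sp : Type*} [TopologicalSpace Sp] [MeasurableSpace Sp] [OpensMeasurableSpace Sp] {F : Type*}
  [Fintype F] {Ω : Type*} [MeasurableSpace Ω]

/-- **E5‴ — THE SIZE BOUND, NE9 ∧ FADING MEMORY ON A TORUS CUBE CHART WITH THE LIP SIDE AND THE KP SIDE DISCHARGED IN THE MIXED CURRENCY
(kernel end-to-end).**  `NE9LinSizeEnd.torus_termSize_ne9_and_fadingMemory_of_linSizeDischargers` (E5′) with: (lip) `ha : threshold ≤ a`,
`hliplb : α₄(k)·2^(ν+1+2^ν) ≤ lip k`, `hlin : ‖c‖ ≤ α₄·e^{−a·d(dom)}` REPLACED by `0 ≤ a`, the volume-entropy scalar `hθ₀ : y·e^{Dθ₀} ≤ θ₀`,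
`hliplb : α₄(k)·θ₀ ≤ lip k` and the MIXED table decay `‖c_ω(Y)‖ ≤ α₄(k)·y^{#dom Y}·e^{−a·d(dom Y)}` ((2.19)∕(2.20) p. 16 TYPE, volume factor
«exp(−¼(κ₁−1)M⁻⁴|Y|)» displayed); (KP) `hdecayLin`, `hrate`, `hsmall` REPLACED by the MIXED majorant decay `∫‖pre‖e^{boxExponent} ≤
ε′ k·y^{#γ′}·e^{−a′·d(γ′)}`, `a″ ≤ a′`, `hθ : 2y·e^{a₁}·e^{Dθ} ≤ θ` (the factor `1 + #γ′` of the segment majorant absorbed as `y ↦ 2y`) and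
`hsmall : 2ε′ k·e^{a″(ν+1)}·θ·(D+1) ≤ a₁` — NO `2^(ν+1+2^ν)` anywhere; the geometry (`hXconn`, `hcmp`), `DecayExtract` = (2.27)
(`decayExtract_linSize`), `PinBudget` (`pinBudget_linSize`, envelope `B = a₁·e^{−a″(ν+1)}`), the recursion side and the CONCLUSION VERBATIM those of
E5′ (rate letter `μ = ω + 4·lipbar·(a₁·e^{−a″(ν+1)})·τ̄`).  Composition BY NAME: `NE9WeightedClauseEnd.termSize_and_ne9_of_weightedClause` ∘
`NE9MixedCurrencyKP.kpClause_of_mixedDecay` ∘ §1–§2.  (A″)∕(L‴)∕the recursion side DISPLAYED; the volume factor in the ACTIVITY majorant is the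
instancer's choice (header rider of `NE9MixedCurrencyKP`); nothing of [I]–[III] asserted; rung (B)+1 bookkeeping on a finite torus.
[cite: Balaban1988RG2Cluster, (1.26) p.8, (1.36) p.9, (2.18)-(2.20) p.16, (2.26)-(2.27) pp.17-18, Lemma 3 (2.38) p.20, (2.40)-(2.41) p.21; Balaban1987RG1, (0.23) p.256, p.257, (1.18) p.263; KoteckyPreiss1986, (1)-(3)] -/
theorem torus_termSize_ne9_and_fadingMemory_of_mixedDischargers (Γ : CubeChart C (Fin ν → ZMod N) (torusAdj ν N) D)
    {ι : Type} {E : Functional C Bg}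
    {W : Set (ℕ → ℝ)} {Adm : Set (Bg → C.Dom → ℝ)} {T : ℕ → (ℕ → ℝ) → (Bg → C.Dom → ℝ) → ι → ℝ}
    {Ψ : ℕ → ℝ → (ι → ℝ) → Bg → C.Dom → ℝ}
    {μ : ℕ → ℝ → Bg → Finset (Fin ν → ZMod N) → Measure Ω} {pre : ℕ → ℝ → Bg → Finset (Fin ν → ZMod N) → Ω → ℂ}
    {c : ℕ → ℝ → Bg → Finset (Fin ν → ZMod N) → Ω → F → ℂ}
    {pt : ℕ → ℝ → Bg → Finset (Fin ν → ZMod N) → Ω → F → Sp} {β : ℕ → Sp → ℝ}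
    {dom : ℕ → Finset (Fin ν → ZMod N) → F → Finset (Fin ν → ZMod N)}
    {lip ε' α4 : ℕ → ℝ} {a₁ a'' κ lipbar ℓ τbar ω a a' y θ θ₀ : ℝ} {wt : ℕ → ι → ℝ} {τ : ℕ → ℕ → ℝ} {lam p₀ Nsz : ℕ → ℝ}
    (ρ : ℕ → (ι → ℝ) → (Sp →ᵇ ℂ))
    -- recursion side (displayed, named binders of the P2 leaves)
    (h0 : ScaleZeroFree E W) (hAdm : AdmissibleTerms E W Adm) (hres : AdmRestrict Adm)
    (hadd : ChannelAdditive Adm T) (hsum : ChannelStepSum Adm T) (hstep : ChannelSizeAtStepNN Adm T κ wt τ)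
    (hfac : Factorises E W T Ψ) (hlast : LastCouplingLipschitz E W T Ψ κ lam)
    (hρ : ∀ (k : ℕ) (P P' : ι → ℝ) (M : ℝ), (∀ y, |P y - P' y| ≤ wt k y * M) → ‖ρ k P - ρ k P'‖ ≤ M)
    (hΨ : ∀ (k : ℕ) (s : ℝ) (P P' : ι → ℝ) (U : Bg) (X : C.Dom),
      Ψ k s P U X - Ψ k s P' U X =
        (Γ.geom.newTerm (Γ.geom.avgExpLinearAct μ pre fun k s U γ ω => evalFunctional (c k s U γ ω) (pt k s U γ ω))
            k s U X (ρ k P) -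
          Γ.geom.newTerm (Γ.geom.avgExpLinearAct μ pre fun k s U γ ω => evalFunctional (c k s U γ ω) (pt k s U γ ω))
            k s U X (ρ k P')).re)
    -- the size-induction data (B0), (X), (N) with B = a₁·e^{−a″(ν+1)}, (R′)
    (hexpl : ∀ g ∈ W, ∀ (k : ℕ) (P : ι → ℝ) (U : Bg) (X : C.Dom), C.scale X = k + 1 →
      |Ψ k (g k) P U X -
          (Γ.geom.newTerm (Γ.geom.avgExpLinearAct μ pre fun k s U γ ω => evalFunctional (c k s U γ ω) (pt k s U γ ω))
            k (g k) U X (ρ k P)).re| ≤ Real.exp (-(κ * C.d X)) * p₀ k)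
    (hbase : ∀ g ∈ W, ∀ (U : Bg) (X : C.Dom), C.scale X = 0 → |E g U X| ≤ Real.exp (-(κ * C.d X)) * Nsz 0)
    (hNsucc : ∀ j, p₀ j + a₁ * Real.exp (-(a'' * (ν + 1))) ≤ Nsz (j + 1)) (hNnn : ∀ j, 0 ≤ Nsz j)
    (hbox : ∀ (k : ℕ) (P : ι → ℝ), (∀ y, |P y| ≤ wt k y * sizeRadius τ Nsz k) → ∀ x, ‖ρ k P x‖ ≤ β k x)
    -- activity side: regularity data, scales, ONE integrability, support of the coefficients
    (hpre : ∀ k s U γ, AEStronglyMeasurable (pre k s U γ) (μ k s U γ))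
    (hc : ∀ k s U γ Y, AEStronglyMeasurable (fun ω => c k s U γ ω Y) (μ k s U γ))
    (hpt : ∀ k s U γ Y, Measurable fun ω => pt k s U γ ω Y) (hlip : ∀ k, 0 < lip k) (hlipb : ∀ k, lip k ≤ lipbar)
    (hint₀ : ∀ k s U γ, Integrable (fun ω => ‖pre k s U γ ω‖ * Real.exp (boxExponent c pt β k s U γ ω)) (μ k s U γ))
    (hmeet : ∀ k s U (γ : Finset (Fin ν → ZMod N)) ω Y, c k s U γ ω Y ≠ 0 → ∃ x ∈ γ, x ∈ dom k γ Y)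
    -- (L‴) decay of the coefficient tables in the MIXED currency + the pinned sums with VOLUME entropy (`hθ₀`, `hliplb`)
    (hα4 : ∀ k, 0 ≤ α4 k) (hy : 0 ≤ y) (ha : 0 ≤ a) (hθ₀ : y * Real.exp (D * θ₀) ≤ θ₀)
    (hliplb : ∀ k, α4 k * θ₀ ≤ lip k)
    (hlin : ∀ k s U (γ : Finset (Fin ν → ZMod N)) ω Y,
      ‖c k s U γ ω Y‖ ≤ α4 k * y ^ (dom k γ Y).card * Real.exp (-(a * (linSize (dom k γ Y) : ℝ))))
    (hdomconn : ∀ k (γ : Finset (Fin ν → ZMod N)) Y, (dom k γ Y).Nonempty →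
      ∃ b ∈ dom k γ Y, Polymer.IsConn (torusAdj ν N) (dom k γ Y) b)
    (hdominj : ∀ k (γ : Finset (Fin ν → ZMod N)), Set.InjOn (dom k γ) {Y | (dom k γ Y).Nonempty})
    -- the d-currency geometry: wall-connected domain cubes ([I] p.257), comparability `κ·C.d X ≤ a″·d(cubes X)`
    (hXconn : ∀ X, ∃ b, Polymer.IsConn (torusAdj ν N) (Γ.cubes X) b)
    (hcmp : ∀ X, κ * C.d X ≤ a'' * (linSize (Γ.cubes X) : ℝ))
    -- (A″) decay of the box majorant in the MIXED currency, `a″ ≤ a′`, the VOLUME entropy condition (at `2y`) and the smallness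
    (hε' : ∀ k, 0 ≤ ε' k)
    (hdecayMix : ∀ g ∈ W, ∀ (k : ℕ) (U : Bg) (X : C.Dom), C.scale X = k + 1 → ∀ γ' ∈ Γ.vol X,
      ∫ ω, ‖pre k (g k) U γ' ω‖ * Real.exp (boxExponent c pt β k (g k) U γ' ω) ∂(μ k (g k) U γ') ≤
        ε' k * y ^ γ'.card * Real.exp (-(a' * (linSize γ' : ℝ))))
    (ha₁ : 0 ≤ a₁) (ha'' : 0 ≤ a'') (haa : a'' ≤ a')
    (hθ : 2 * y * Real.exp a₁ * Real.exp (D * θ) ≤ θ)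
    (hsmall : ∀ k, 2 * ε' k * Real.exp (a'' * (ν + 1)) * θ * ((D : ℝ) + 1) ≤ a₁)
    -- envelope data
    (hℓ : 0 ≤ ℓ) (hτbar : 0 ≤ τbar) (hω : 0 ≤ ω) (hpos : 0 < ω + 4 * lipbar * (a₁ * Real.exp (-(a'' * (ν + 1)))) * τbar)
    (hlam : ∀ k, lam k ≤ ℓ) (hτ : ∀ k j, j ≤ k → 0 ≤ τ k j ∧ τ k j ≤ τbar * ω ^ (k - j)) :
    TermSize E W κ Nsz ∧
      NE9 E W κ (prodModuli ℓ fun _ => ω + 4 * lipbar * (a₁ * Real.exp (-(a'' * (ν + 1)))) * τbar) ∧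
        FadingMemory (ℓ / (ω + 4 * lipbar * (a₁ * Real.exp (-(a'' * (ν + 1)))) * τbar))
          (ω + 4 * lipbar * (a₁ * Real.exp (-(a'' * (ν + 1)))) * τbar)
          (prodModuli ℓ fun _ => ω + 4 * lipbar * (a₁ * Real.exp (-(a'' * (ν + 1)))) * τbar) := by
  -- (L′) from (L‴) in the mixed currency (§1)
  have hL : ∀ k s U (γ : Finset (Fin ν → ZMod N)) ω, coeffSum c k s U γ ω ≤ lip k * (γ.card : ℝ) :=
    coeffSum_le_of_pinned hmeet
      (pin_of_mixedDecay (G := ZMod N) Γ.deg hα4 hy ha hθ₀ hliplb hlin (fun k γ Y hY => hdomconn k γ Y hY) hdominj)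
  -- the KP clause on the box majorant in the mixed currency (`NE9MixedCurrencyKP.kpClause_of_mixedDecay` ∘ §2)
  have hM0 : ∀ (k : ℕ) (s : ℝ) (U : Bg) (γ' : Finset (Fin ν → ZMod N)),
      0 ≤ 2 * ((1 + ((γ' : Finset (Fin ν → ZMod N)).card : ℝ)) *
        ∫ ω, ‖pre k s U γ' ω‖ * Real.exp (boxExponent c pt β k s U γ' ω) ∂(μ k s U γ')) := fun k s U γ' =>
    mul_nonneg (by norm_num) (mul_nonneg (by positivity)
      (integral_nonneg fun _ => mul_nonneg (norm_nonneg _) (Real.exp_pos _).le))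
  have h2y : 0 ≤ 2 * y := by positivity
  have hkp := kpClause_of_mixedDecay Γ.supported (W := W)
    (M := fun k s U γ' => 2 * ((1 + ((γ' : Finset (Fin ν → ZMod N)).card : ℝ)) *
      ∫ ω, ‖pre k s U γ' ω‖ * Real.exp (boxExponent c pt β k s U γ' ω) ∂(μ k s U γ')))
    (ε := fun k => 2 * ε' k) (y := 2 * y) (a' := a') (a'' := a'') (a₁ := a₁) (θ := θ)
    (fun k => by have := hε' k; positivity) h2y hM0
    (fun g hg k U X hX γ' hγ' => two_mul_one_add_card_mul_le_mixed (hε' k) hy (hdecayMix g hg k U X hX γ' hγ'))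
    haa (by simpa only [mul_assoc] using hθ) hsmall
  have hB : 0 ≤ a₁ * Real.exp (-(a'' * (ν + 1))) := mul_nonneg ha₁ (Real.exp_nonneg _)
  exact termSize_and_ne9_of_weightedClause Γ ρ h0 hAdm hres hadd hsum hstep hfac hlast hρ hΨ hexpl hbase hNsucc hNnn hbox
    hpre hc hpt hlip hlipb hint₀ hL (Γ.supported.sizeWeight_nonneg ha₁)
    (fun γ => mul_nonneg ha'' (by positivity)) hkp
    (decayExtract_linSize Γ (fun _ _ h => h) ha'' hXconn) (pinBudget_linSize Γ ha₁ hcmp) hB hℓ hτbar hω hpos hlam hτ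

end Torus

end Summit.QuantumFields.BalabanUV.T4Continuum.NE9MixedCurrencyEnd

end
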